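import Summits.ValiantsHypothesis.ValiantsHypothesis.Theorems.GrenetZeonTwoDimCoefficientsDefs
import Literature.Computability.AlgebraicComplexity.MignonRessayreBound
import Literature.Computability.AlgebraicComplexity.PermanentIrreducible
import Literature.Computability.AlgebraicComplexity.StandardFamiliesProofs
import Literature.LinearAlgebra.Matrix.MvPolynomialDetDegree
import HarnessLib

/-!
# Crux `GrenetZeon.TwoDimCoefficients` (stmt-ValiantsHypothesis-8062), line `dim2_cases`:
# the UNIT CASE — what is provable about `stub_unitDichotomy`

Helpers for (and the honest calibration of) the registered stub `stub_unitDichotomy`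
(`UnitDichotomy`: for `n ≥ 3` and an affine `m × m` matrix `A` over `ℂ[x]` whose determinant has no
zero on the permanental hypersurface `Z(per_n)`, either `det A` is constant or `n² ≤ 2m + 2`).

Proved here, unconditionally:

* `eval_eq_eval_zero_of_perPoly` / `exists_eq_C_add_perPoly_mul` — THE UNIT STRUCTURE.  A polynomial
  `g` with no zero on `Z(per_n)` (`n ≥ 1`) is `g = c + per_n · q` with `c = g(0) ≠ 0`.  Proof: for
  `p ∈ Z(per_n)` the whole line `ℂ·p` lies in the cone `Z(per_n)`, so `t ↦ g(t p)` is a complex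
  polynomial in one variable without zeros, hence constant (`Complex.exists_root`): `g ≡ g(0)` on
  `Z(per_n)`; then `g - g(0)` lies in the vanishing ideal of `Z(per_n)`, which is the prime ideal
  `(per_n)` by the Nullstellensatz (`MvPolynomial.IsPrime.vanishingIdeal_zeroLocus`) and the
  irreducibility of the permanent (tree: `perPoly_irreducible`).  (This replaces the card's
  "graded units" argument.)
* `sq_le_two_mul_of_det_eq_C_add_C_mul_perPoly` — THE LEVEL-SET BOUND (the case `q` constant,
  `q ≠ 0`): if `det A = c + b·per_n` with `b ≠ 0`, `n ≥ 3`, then `n² ≤ 2m`.  Proof: the level set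
  `{per_n = -c/b} = Z(det A)` contains a dilate `λ·y` of a point `y` with `per_n(y) ≠ 0` and
  non-degenerate Hessian (such `y` exist: `per_n · det(∂²per_n)` is a non-zero polynomial, non-zero
  at a point by `MvPolynomial.funext`; `det(∂²per_n) ≠ 0` at the Mignon–Ressayre point, tree:
  `hess0_transl_mrPoint_perPoly`, `mrHess_mulVec_injective`), the Hessian of `per_n` at `λ·y` is
  `λ^{n-2}` times that at `y` (homogeneity), so `rank Hess(det A)(λ y) = n²`, while the tree's
  `rank_hess0_det_le` (Mignon–Ressayre) gives `≤ 2m` at any zero of an affine determinant.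
* `det_eq_C_of_forall_eval_ne_zero_of_le` — consequence: for `m ≤ n`, `n ≥ 3`, an affine `m × m`
  determinant with no zero on `Z(per_n)` is CONSTANT.
* `unit_trichotomy` — the honest form of the dichotomy that these tools give for every `m`:
  `det A` constant, or `n² ≤ 2m`, or `det A = c + per_n·q` with `q` NON-CONSTANT.

NOT proved, and why (calibration of the registered stub, see the seat's census note attached to
the item): in the third case the card's "asymptotic Mignon–Ressayre point" needs a zero `P` of
`det A` with `rank Hess(det A)(P) ≥ n² - 2`; no such zero exists when `det A` is a powerful
polynomial, e.g. `det A = ((per_n + 1)/2)²` — and `per_n = ((per_n+1)/2)² - ((per_n-1)/2)²` is a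
SPLIT representation both of whose determinants are units mod `per_n`.  So `UnitDichotomy` as
registered asserts, among other things, `dc(((per_n+1)/2)²) ≥ (n²-2)/2`, a lower bound for the
determinantal complexity of a SQUARE for which the Hessian method is void; it is not settled here.

HONEST FRAMING: helper lemmas for an ASIDE item; nothing here moves `VP ≠ VNP`.

References: T. Mignon, N. Ressayre, *A quadratic bound for the determinant and permanent problem*,
Int. Math. Res. Not. 2004:79, Thm. 1.1 (Hessian rank at a zero of an affine determinant);
J. M. Landsberg, *Geometry and Complexity Theory*, CUP 2017, §6.4.6 (the point `y₀`).
-/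

set_option linter.dupNamespace false

noncomputable section

namespace Summit.ValiantsHypothesis.ValiantsHypothesis.Cruxes.TwoDimCoefficients.DimTwoCases

open MvPolynomial Matrix
open Literature.Computability.AlgebraicComplexity

/-! ### Homogeneity: values on dilates -/

section Homogeneous

variable {k : Type*} [CommRing k] {σ : Type*} [Fintype σ]

/-- A form `f` of degree `d` satisfies `f(c • x) = c^d f(x)`. -/
theorem eval_smul_of_isHomogeneous (f : MvPolynomial σ k) {d : ℕ} (hf : f.IsHomogeneous d)
    (c : k) (x : σ → k) : eval (c • x) f = c ^ d * eval x f := by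
  rw [eval_eq', eval_eq', Finset.mul_sum]
  refine Finset.sum_congr rfl fun α hα => ?_
  have hdeg : ∑ i, α i = d := by
    have h := hf (mem_support_iff.1 hα)
    rw [Finsupp.weight_apply, Finsupp.sum_fintype _ _ (by simp)] at h
    simpa using h
  simp_rw [Pi.smul_apply, smul_eq_mul, mul_pow, Finset.prod_mul_distrib,
    Finset.prod_pow_eq_pow_sum, hdeg]
  ring

/-- The permanent on a dilate: `per_n(c • x) = c^n per_n(x)`. -/
theorem eval_smul_perPoly {n : ℕ} (c : k) (x : Fin n × Fin n → k) :
    eval (c • x) (perPoly (Fin n) k) = c ^ n * eval x (perPoly (Fin n) k) := by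
  have h := eval_smul_of_isHomogeneous (perPoly (Fin n) k) (perPoly_isHomogeneous (n := Fin n) (k := k)) c x
  rwa [Fintype.card_fin] at h

/-- Second partials of the permanent on a dilate: `(∂_s∂_t per_n)(c • x) = c^{n-2} (∂_s∂_t per_n)(x)`.
-/
theorem eval_smul_pderiv_pderiv_perPoly {n : ℕ} (c : k) (x : Fin n × Fin n → k)
    (s t : Fin n × Fin n) :
    eval (c • x) (pderiv s (pderiv t (perPoly (Fin n) k))) =
      c ^ (n - 2) * eval x (pderiv s (pderiv t (perPoly (Fin n) k))) := by
  have hh : (pderiv s (pderiv t (perPoly (Fin n) k))).IsHomogeneous (n - 2) := by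
    have h := ((perPoly_isHomogeneous (n := Fin n) (k := k)).pderiv (i := t)).pderiv (i := s)
    rwa [Fintype.card_fin, Nat.sub_sub] at h
  exact eval_smul_of_isHomogeneous _ hh c x

/-- The permanent vanishes at the origin (`n ≥ 1`). -/
theorem eval_zero_perPoly {n : ℕ} (hn : 0 < n) : eval (0 : Fin n × Fin n → k) (perPoly (Fin n) k) = 0 := by
  have h := eval_smul_perPoly (n := n) (0 : k) (0 : Fin n × Fin n → k)
  rwa [zero_smul, zero_pow hn.ne', zero_mul] at h

end Homogeneous

/-! ### The unit structure: no zero on `Z(per_n)` forces `g = c + per_n · q` -/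

section UnitStructure

variable {n : ℕ}

/-- Restriction of a polynomial `g` to the line `t ↦ t • p`, as a polynomial in one variable. -/
theorem eval_aeval_C_mul_X (g : MvPolynomial (Fin n × Fin n) ℂ) (p : Fin n × Fin n → ℂ) (t : ℂ) :
    Polynomial.eval t (aeval (fun i => Polynomial.C (p i) * Polynomial.X) g) = eval (t • p) g := by
  have h : (Polynomial.evalRingHom t).comp
      (aeval (R := ℂ) (fun i : Fin n × Fin n => Polynomial.C (p i) * Polynomial.X)).toRingHom =
      eval (t • p) := by
    refine MvPolynomial.ringHom_ext (fun a => ?_) (fun i => ?_)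
    · simp
    · simp only [RingHom.coe_comp, Function.comp_apply, AlgHom.toRingHom_eq_coe, RingHom.coe_coe,
        aeval_X, Polynomial.coe_evalRingHom, Polynomial.eval_mul, Polynomial.eval_C,
        Polynomial.eval_X, eval_X, Pi.smul_apply, smul_eq_mul, mul_comm]
  exact RingHom.congr_fun h g

/-- **On the permanental cone a zero-free polynomial is constant**: if `g` has no zero on
`Z(per_n)` and `per_n(p) = 0`, then `g(p) = g(0)` (the line `ℂ·p` lies in the cone, and a complex
polynomial in one variable without zeros is constant). -/
theorem eval_eq_eval_zero_of_perPoly (g : MvPolynomial (Fin n × Fin n) ℂ)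
    (hg : ∀ p : Fin n × Fin n → ℂ, eval p (perPoly (Fin n) ℂ) = 0 → eval p g ≠ 0)
    (p : Fin n × Fin n → ℂ) (hp : eval p (perPoly (Fin n) ℂ) = 0) :
    eval p g = eval 0 g := by
  set P : Polynomial ℂ := aeval (fun i => Polynomial.C (p i) * Polynomial.X) g with hP
  have hroot : ∀ t : ℂ, Polynomial.eval t P ≠ 0 := by
    intro t
    rw [hP, eval_aeval_C_mul_X]
    apply hg
    rw [eval_smul_perPoly, hp, mul_zero]
  have hdeg : P.degree ≤ 0 := by
    by_contra h
    obtain ⟨z, hz⟩ := Complex.exists_root (not_le.mp h)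
    exact hroot z hz
  have hC := Polynomial.eq_C_of_degree_le_zero hdeg
  have h1 : Polynomial.eval 1 P = Polynomial.eval 0 P := by
    rw [hC, Polynomial.eval_C, Polynomial.eval_C]
  rw [hP, eval_aeval_C_mul_X, eval_aeval_C_mul_X, one_smul, zero_smul] at h1
  exact h1

/-- **The unit structure.** A polynomial `g` with no zero on the permanental hypersurface
`Z(per_n)` (`n ≥ 1`) is `c + per_n · q` with `c = g(0) ≠ 0` (Nullstellensatz and irreducibility of
the permanent). -/
theorem exists_eq_C_add_perPoly_mul (hn : 0 < n) (g : MvPolynomial (Fin n × Fin n) ℂ)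
    (hg : ∀ p : Fin n × Fin n → ℂ, eval p (perPoly (Fin n) ℂ) = 0 → eval p g ≠ 0) :
    ∃ (c : ℂ) (q : MvPolynomial (Fin n × Fin n) ℂ), c ≠ 0 ∧ g = C c + perPoly (Fin n) ℂ * q := by
  haveI : Nonempty (Fin n) := ⟨⟨0, hn⟩⟩
  set c : ℂ := eval 0 g with hc
  have hc0 : c ≠ 0 := hg 0 (eval_zero_perPoly hn)
  -- `g - c` vanishes on `Z(per_n)`
  have hmem : g - C c ∈ vanishingIdeal ℂ
      (zeroLocus ℂ (Ideal.span {perPoly (Fin n) ℂ} : Ideal (MvPolynomial (Fin n × Fin n) ℂ))) := by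
    rw [mem_vanishingIdeal_iff]
    intro x hx
    rw [zeroLocus_span, Set.mem_setOf_eq] at hx
    have hx' : eval x (perPoly (Fin n) ℂ) = 0 := by
      have := hx _ (Set.mem_singleton _)
      rwa [aeval_eq_eval] at this
    rw [aeval_eq_eval, map_sub, eval_C, eval_eq_eval_zero_of_perPoly g hg x hx', hc, sub_self]
  -- the ideal `(per_n)` is prime, hence equal to its own vanishing ideal of zeros
  haveI hprime :
      (Ideal.span {perPoly (Fin n) ℂ} : Ideal (MvPolynomial (Fin n × Fin n) ℂ)).IsPrime :=
    (Ideal.span_singleton_prime (perPoly_irreducible (n := Fin n) (R := ℂ)).ne_zero).mpr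
      (UniqueFactorizationMonoid.irreducible_iff_prime.mp (perPoly_irreducible (n := Fin n) (R := ℂ)))
  rw [MvPolynomial.IsPrime.vanishingIdeal_zeroLocus, Ideal.mem_span_singleton'] at hmem
  obtain ⟨q, hq⟩ := hmem
  exact ⟨c, q, hc0, by rw [mul_comm, hq]; ring⟩

end UnitStructure

/-! ### The level-set bound: `det A = c + b · per_n`, `b ≠ 0`, forces `n² ≤ 2m` -/

section LevelSet

/-- The matrix of second partials of the permanent, as a matrix of polynomials; its value at a
point is the Hessian there (`hess0 ∘ transl`, tree: `hess0_transl`). -/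
theorem eval_mapMatrix_pderiv_pderiv_perPoly {k : Type*} [CommRing k] {n : ℕ}
    (y : Fin n × Fin n → k) :
    (eval y).mapMatrix (Matrix.of fun s t => pderiv s (pderiv t (perPoly (Fin n) k))) =
      hess0 (transl y (perPoly (Fin n) k)) := by
  ext s t
  rw [RingHom.mapMatrix_apply, Matrix.map_apply, Matrix.of_apply, hess0_transl]

/-- The Hessian of the permanent at a dilate: `H(per_n)(c • y) = c^{n-2} • H(per_n)(y)`. -/
theorem hess0_transl_smul_perPoly {k : Type*} [CommRing k] {n : ℕ} (c : k) (y : Fin n × Fin n → k) :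
    hess0 (transl (c • y) (perPoly (Fin n) k)) = c ^ (n - 2) • hess0 (transl y (perPoly (Fin n) k)) := by
  ext s t
  rw [hess0_transl, Matrix.smul_apply, hess0_transl, smul_eq_mul, eval_smul_pderiv_pderiv_perPoly]

/-- There is a point off the permanental hypersurface with non-degenerate Hessian (`n ≥ 3`): the
polynomial `per_n · det(∂²per_n)` is non-zero (at the Mignon–Ressayre point the Hessian is
invertible), hence non-zero somewhere. -/
theorem exists_eval_perPoly_ne_zero_and_isUnit_hess0 (k : ℕ) :
    ∃ y : Fin (k + 3) × Fin (k + 3) → ℂ, eval y (perPoly (Fin (k + 3)) ℂ) ≠ 0 ∧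
      IsUnit (hess0 (transl y (perPoly (Fin (k + 3)) ℂ))).det := by
  classical
  set HP : Matrix (Fin (k + 3) × Fin (k + 3)) (Fin (k + 3) × Fin (k + 3))
      (MvPolynomial (Fin (k + 3) × Fin (k + 3)) ℂ) :=
    Matrix.of fun s t => pderiv s (pderiv t (perPoly (Fin (k + 3)) ℂ)) with hHP
  have hdet : ∀ y, eval y HP.det = (hess0 (transl y (perPoly (Fin (k + 3)) ℂ))).det := fun y => by
    rw [RingHom.map_det, hHP, eval_mapMatrix_pderiv_pderiv_perPoly]
  -- at the Mignon–Ressayre point the Hessian is `k! • mrHess`, invertible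
  have hMR : IsUnit (hess0 (transl (mrPoint ℂ k) (perPoly (Fin (k + 3)) ℂ))).det := by
    rw [hess0_transl_mrPoint_perPoly, ← Matrix.isUnit_iff_isUnit_det]
    refine Matrix.mulVec_injective_iff_isUnit.mp fun v w hvw => mrHess_mulVec_injective ?_
    simp only [Matrix.smul_mulVec] at hvw
    exact smul_right_injective _ (by exact_mod_cast Nat.factorial_ne_zero k : (k.factorial : ℂ) ≠ 0) hvw
  have hF : perPoly (Fin (k + 3)) ℂ * HP.det ≠ 0 := by
    refine mul_ne_zero (perPoly_irreducible (n := Fin (k + 3)) (R := ℂ)).ne_zero fun h => ?_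
    have := hdet (mrPoint ℂ k)
    rw [h, map_zero] at this
    exact hMR.ne_zero this.symm
  by_contra hall
  push Not at hall
  apply hF
  apply MvPolynomial.funext
  intro y
  rw [map_mul, map_zero]
  by_cases hy : eval y (perPoly (Fin (k + 3)) ℂ) = 0
  · rw [hy, zero_mul]
  · have h := hall y hy
    rw [← hdet, isUnit_iff_ne_zero, not_not] at h
    rw [h, mul_zero]

/-- **The level-set bound.** If an affine `m × m` determinant is `c + b · per_n` with `b ≠ 0` and
`n ≥ 3`, then `n² ≤ 2m`: the level set `{per_n = -c/b}` of the permanent is the zero set of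
`det A`, and it contains a point with a Hessian of full rank `n²` (a dilate of a point with
non-degenerate Hessian), where Mignon–Ressayre's `rank_hess0_det_le` gives `≤ 2m`. -/
theorem sq_le_two_mul_of_det_eq_C_add_C_mul_perPoly {k m : ℕ} (A : AffMat (k + 3) m)
    (hA : IsAffine A) {c b : ℂ} (hb : b ≠ 0)
    (hdet : A.det = C c + C b * perPoly (Fin (k + 3)) ℂ) : (k + 3) ^ 2 ≤ 2 * m := by
  classical
  -- a zero `x` of `det A` at which the Hessian of `per` has full rank
  obtain ⟨x, hx, hrank⟩ : ∃ x : Fin (k + 3) × Fin (k + 3) → ℂ,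
      eval x (perPoly (Fin (k + 3)) ℂ) = -c / b ∧
      (hess0 (transl x (perPoly (Fin (k + 3)) ℂ))).rank = (k + 3) ^ 2 := by
    by_cases hc : c = 0
    · refine ⟨mrPoint ℂ k, ?_, ?_⟩
      · rw [eval_mrPoint_perPoly, hc, neg_zero, zero_div]
      · rw [hess0_transl_mrPoint_perPoly, rank_smul_eq (by exact_mod_cast Nat.factorial_ne_zero k),
          rank_mrHess]
    · obtain ⟨y, hy, hunit⟩ := exists_eval_perPoly_ne_zero_and_isUnit_hess0 k
      have hq : (-c / b) / eval y (perPoly (Fin (k + 3)) ℂ) ≠ 0 :=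
        div_ne_zero (div_ne_zero (neg_ne_zero.mpr hc) hb) hy
      obtain ⟨lam, hlam⟩ :=
        IsAlgClosed.exists_pow_nat_eq ((-c / b) / eval y (perPoly (Fin (k + 3)) ℂ))
          (by omega : 0 < k + 3)
      have hlam0 : lam ≠ 0 := by
        rintro rfl
        rw [zero_pow (by omega : k + 3 ≠ 0)] at hlam
        exact hq hlam.symm
      refine ⟨lam • y, ?_, ?_⟩
      · rw [eval_smul_perPoly, hlam, div_mul_cancel₀ _ hy]
      · rw [hess0_transl_smul_perPoly, rank_smul_eq (pow_ne_zero _ hlam0),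
          Matrix.rank_of_isUnit _ ((Matrix.isUnit_iff_isUnit_det _).mpr hunit), Fintype.card_prod,
          Fintype.card_fin, sq]
  have hdeg : ∀ i j, ((transl x).mapMatrix A i j).totalDegree ≤ 1 := fun i j =>
    (totalDegree_transl_le _ _).trans (hA i j)
  have hdet' : ((transl x).mapMatrix A).det = C c + C b * transl x (perPoly (Fin (k + 3)) ℂ) := by
    rw [← AlgHom.map_det, hdet, map_add, map_mul, transl_C, transl_C]
  have h0 : constantCoeff ((transl x).mapMatrix A).det = 0 := by
    rw [hdet', map_add, map_mul, constantCoeff_C, constantCoeff_C, constantCoeff_transl, hx,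
      mul_div_cancel₀ _ hb, add_neg_cancel]
  have hr := rank_hess0_det_le _ hdeg h0
  rwa [hdet', map_add, hess0_C_mul, hess0_eq_zero_of_totalDegree_le_one (by simp), zero_add,
    rank_smul_eq hb, hrank] at hr

end LevelSet

/-! ### Packaging: what the tools give for the registered dichotomy -/

section Packaging

variable {n : ℕ}

/-- Degree bookkeeping: if `det A = c + per_n · q` for an affine `m × m` matrix `A` and `q ≠ 0`,
then `n + deg q ≤ m`. -/
theorem add_totalDegree_le_of_det_eq (hn : 0 < n) {m : ℕ} (A : AffMat n m) (hA : IsAffine A)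
    {c : ℂ} {q : MvPolynomial (Fin n × Fin n) ℂ} (hq : q ≠ 0)
    (hdet : A.det = C c + perPoly (Fin n) ℂ * q) : n + q.totalDegree ≤ m := by
  haveI : Nonempty (Fin n) := ⟨⟨0, hn⟩⟩
  have hper : (perPoly (Fin n) ℂ).totalDegree = n := by
    rw [(totalDegree_perPoly_holds (n := Fin n) (k := ℂ) : (perPoly (Fin n) ℂ).totalDegree = _),
      Fintype.card_fin]
  have hprod : (perPoly (Fin n) ℂ * q).totalDegree = n + q.totalDegree := by
    rw [totalDegree_mul_of_isDomain (perPoly_irreducible (n := Fin n) (R := ℂ)).ne_zero hq, hper]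
  have hsum : (C c + perPoly (Fin n) ℂ * q).totalDegree = n + q.totalDegree := by
    rw [totalDegree_add_eq_right_of_totalDegree_lt, hprod]
    rw [hprod, totalDegree_C]
    omega
  have hle : A.det.totalDegree ≤ m := by
    refine (Literature.LinearAlgebra.Matrix.totalDegree_det_le A (fun _ => 1) fun i j => hA i j).trans
      ?_
    simp
  rw [hdet, hsum] at hle
  exact hle

/-- **The honest trichotomy** (what the Hessian method gives for every `m`): for `n ≥ 3` and an
affine `m × m` matrix `A` whose determinant has no zero on `Z(per_n)`, either `det A` is constant,
or `n² ≤ 2m`, or `det A = c + per_n · q` with `c ≠ 0` and `q` NON-CONSTANT (the residual case of the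
registered `UnitDichotomy`, which contains the powerful determinants `((per_n + 1)/2)²`, …). -/
theorem unit_trichotomy (hn : 3 ≤ n) (m : ℕ) (A : AffMat n m) (hA : IsAffine A)
    (hZ : ∀ p : Fin n × Fin n → ℂ, eval p (perPoly (Fin n) ℂ) = 0 → eval p A.det ≠ 0) :
    (∃ c : ℂ, A.det = C c) ∨ n ^ 2 ≤ 2 * m ∨
      ∃ (c : ℂ) (q : MvPolynomial (Fin n × Fin n) ℂ), c ≠ 0 ∧ 0 < q.totalDegree ∧
        A.det = C c + perPoly (Fin n) ℂ * q := by
  obtain ⟨c, q, hc, hdet⟩ := exists_eq_C_add_perPoly_mul (by omega) A.det hZ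
  by_cases hq : q.totalDegree = 0
  · rw [totalDegree_eq_zero_iff_eq_C] at hq
    by_cases hb : q.coeff 0 = 0
    · exact Or.inl ⟨c, by rw [hdet, hq, hb, C_0, mul_zero, add_zero]⟩
    · obtain ⟨k, rfl⟩ : ∃ k, n = k + 3 := ⟨n - 3, by omega⟩
      refine Or.inr (Or.inl (sq_le_two_mul_of_det_eq_C_add_C_mul_perPoly A hA (c := c) hb ?_))
      rw [hdet, hq, mul_comm, coeff_zero_C]
  · exact Or.inr (Or.inr ⟨c, q, hc, Nat.pos_of_ne_zero hq, hdet⟩)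

/-- **Small affine determinants without zeros on `Z(per_n)` are constant**: for `n ≥ 3` and
`m ≤ n`, an affine `m × m` matrix whose determinant never vanishes on the permanental hypersurface
has constant determinant (degree count plus the level-set bound). -/
theorem det_eq_C_of_forall_eval_ne_zero_of_le (hn : 3 ≤ n) {m : ℕ} (hmn : m ≤ n) (A : AffMat n m)
    (hA : IsAffine A)
    (hZ : ∀ p : Fin n × Fin n → ℂ, eval p (perPoly (Fin n) ℂ) = 0 → eval p A.det ≠ 0) :
    ∃ c : ℂ, A.det = C c := by
  rcases unit_trichotomy hn m A hA hZ with h | h | ⟨c, q, -, hq, hdet⟩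
  · exact h
  · exfalso; nlinarith
  · exfalso
    have hq0 : q ≠ 0 := by rintro rfl; simp at hq
    have := add_totalDegree_le_of_det_eq (by omega) A hA hq0 hdet
    omega

end Packaging

end Summit.ValiantsHypothesis.ValiantsHypothesis.Cruxes.TwoDimCoefficients.DimTwoCases
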